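import Summits.QuantumFields.YangMills.Theorems.SmallFieldWideningPlainStabAddOfLocalStep

/-!
# Route `SmallFieldWidening`, crux `PlainStabAdd` (stmt-QuantumFields-27718; LINE g6-B «additive unit-stability ladder», child of crux r3 `LargeFieldMassRefinementTail`
# stmt-QuantumFields-22884) — THE INTERFACE OF RECORD `LocalStepFloor` WITH AN EXPLICIT SLACK RATE: ONE precision `η < min(c_b, (b'/b₀)²/4)` instead of «every η > 0»
# (support file; width seat `ym-line-sfw-p2-w3` gen 24; refines p633597 `…PlainStabAddOfLocalStepFloor` per the planner's RULING 2026-08-28T12:13:19Z n1 «stub 1 may be weakened to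
# ∀ η ≥ η₀ for any explicit η₀ below the landed slack rate»; `PlainStabAdd`, r3 and rung R3 stay OPEN — the YM mass gap is NOT proved by any of this)

WHAT.  §1 `finestTail_quarter`: the tree's bare single-plaquette tail ([FrohlichIsraelLiebSimon1978]-type engine `T3FinestHeightTail.gibbsMeasure_real_dist1_ge_le`, `SU(2)`, `d = 3`)
read at the FINEST level of run `K` with Bałaban's threshold `θ_b(K) = g_K p_b(g_K)`: `Gibbs_K{θ_b(K) ≤ |U(∂p) − 1|} ≤ C₀·β_K⁵·e^{−p_b(g_K)²/4}` for EVERY profile `b > 0`, every family, every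
`0 < γ ≤ 1` — the RATE `1/4` of [Balaban1985UV3] (71) EXPLICIT (only the prefactor `C₀ = 2e^{24}c₀⁻³` is existential), no threshold window needed (no averaging at height `0`).
§2 ★★ `plainStabAdd_of_localStepFloorExplicit`: `PlainStabAdd` BY NAME from `LocalStepFloorExplicit` = the interface of record `LocalStepFloor` (p633597) with its «∀ η > 0 ∃ (k₀ N_b M γ₁ C_b A)»
replaced by «∃ η (k₀ N_b M γ₁ C_b A), 0 ≤ η < c_b ∧ η < (b'/b₀)²/4»: the supplier proves the interval bounds `Σ_{k≤j<K} ρ_j ≤ A + η·p(√γ)²` for ONE precision `η` of his choice below the base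
rate `c_b` and below the EXPLICIT slack rate `(b'/b₀)²/4` of the finest guard at profile `b'` (in units of `p_{b₀}²`).  Proof = the proof of `plainStabAdd_of_localStepFloor` with the finest
tail of §1 (`c = 1/4`, `N = 5`) in place of `FirstExitDeepBoundedHeight.perPlaquette_boundedHeight_uniform 0`, the slack summed by `PlainStabAddOfLocalStep.slack_sum_le`.
Trivially `LocalStepFloor ⇒ LocalStepFloorExplicit` (take `η := min(c_b, (b'/b₀)²/4)/2`), so this is the WEAKEST landed sufficient condition of the line.

WHAT THIS IS NOT.  The hypothesis is NOT proved (XL: [Balaban1985UV3] (7), (70)–(71); [Balaban1987RG1] Thm 1; [Balaban1989LargeFieldII] §1 — densities, not event probabilities);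
nothing bears on the Yang–Mills mass gap; rung R3 (`YM3TorusSU2`) is a RECORD rung; cruxes 27718 / 22884 stay open.
-/

noncomputable section

open MeasureTheory Filter Topology
open scoped BigOperators
open Literature.MathematicalPhysics.QuantumFieldTheory.Balaban1983to89
open Literature.MathematicalPhysics.QuantumFieldTheory.Balaban1983to89.Missing
open Literature.MathematicalPhysics.QuantumFieldTheory.Balaban1983to89.T3ContinuumYM3Torus
open Literature.MathematicalPhysics.QuantumFieldTheory.Balaban1983to89.T3UnitScaleTilt
open Literature.MathematicalPhysics.QuantumFieldTheory.Balaban1983to89.T3UnitLawDensityEML (ℰp)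
open Literature.MathematicalPhysics.QuantumFieldTheory.Balaban1983to89.T3LevelShift
open Literature.MathematicalPhysics.QuantumFieldTheory.Balaban1983to89.T3FinestHeightTail (gibbsMeasure_real_dist1_ge_le beta_mul_θBal_sq)
open Summit.QuantumFields.YangMills.Theorems.PlainStabAddOfLocalStep (slack_sum_le pFun_sq_rescale)

namespace Summit.QuantumFields.YangMills.Theorems.PlainStabAddOfLocalStepFloorExplicit

/-! ## §1 The finest-level plaquette tail with the explicit rate `1/4` -/

/-- ★ **THE FINEST-LEVEL PLAQUETTE TAIL, RATE `1/4` EXPLICIT, EVERY PROFILE**: there is `C₀ ≥ 0` such that for every family `F`, every `0 < γ ≤ 1`, every profile `b > 0`, `p₀`,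
every run `K` and finest plaquette `p`: `Gibbs_K{θ_b(K) ≤ |U(∂p) − 1|} ≤ C₀·((γL^{-K})⁻¹)⁵·exp(−p_b(g_K)²/4)` (`β_Kθ_b(K)² = p_b(g_K)²`, `(√β_K)⁹ ≤ β_K⁵`).
[cite: Balaban1985UV3, (7) p.257 and (71) p.273] -/
theorem finestTail_quarter :
    ∃ C₀ : ℝ, 0 ≤ C₀ ∧ ∀ (F : T3Family) (γ b p₀ : ℝ), 0 < γ → γ ≤ 1 → 0 < b → ∀ (K : ℕ) (p : Plaq (F.P K) 0),
      (gibbsK F ℰp γ K).real {U | θBal F.L γ b p₀ K ≤ GaugeGroup.dist1 (GaugeField.plaqHol U p)} ≤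
        C₀ * ((γ * ((F.L : ℝ)⁻¹) ^ K)⁻¹) ^ 5 * Real.exp (-(1 / 4 * B10.pFun b p₀ (Real.sqrt (γ * ((F.L : ℝ)⁻¹) ^ K)) ^ 2)) := by
  obtain ⟨c₀, hc₀, _hc₀1, htail⟩ := gibbsMeasure_real_dist1_ge_le (N := 2)
  refine ⟨2 * Real.exp 24 * (c₀ ^ 3)⁻¹, by positivity, fun F γ b p₀ hγ hγ1 hb K p => ?_⟩
  haveI := isProbabilityMeasure_gibbsK F ℰp hγ.le K
  have hL1 : (1 : ℝ) ≤ F.L := by exact_mod_cast F.hL.2.le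
  have hL0 : (0 : ℝ) < F.L := by linarith
  set x : ℝ := γ * ((F.L : ℝ)⁻¹) ^ K with hx
  have hx0 : 0 < x := mul_pos hγ (pow_pos (inv_pos.2 hL0) K)
  have hx1 : x ≤ 1 := mul_le_one₀ hγ1 (pow_nonneg (inv_nonneg.2 hL0.le) K)
    (pow_le_one₀ (inv_nonneg.2 hL0.le) (inv_le_one_of_one_le₀ hL1))
  -- `β_K = x⁻¹ ≥ 1`
  have hβ : (F.scheme ℰp γ).β K = x⁻¹ := rfl
  have hβ1 : 1 ≤ (F.scheme ℰp γ).β K := by rw [hβ]; exact (one_le_inv₀ hx0).2 hx1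
  have hβ0 : 0 ≤ (F.scheme ℰp γ).β K := zero_le_one.trans hβ1
  -- the threshold is non-negative
  have hg1 : Real.sqrt x ≤ 1 := Real.sqrt_le_one.mpr hx1
  have hg0 : 0 < Real.sqrt x := Real.sqrt_pos.mpr hx0
  have hθ : 0 ≤ θBal F.L γ b p₀ K := mul_nonneg (Real.sqrt_nonneg _) (B10.pFun_nonneg b p₀ _ hb.le hg0 hg1)
  have h := htail (F.P K) ((F.scheme ℰp γ).β K) hβ1 (θBal F.L γ b p₀ K) hθ p
  rw [gibbsK_eq]
  refine h.trans ?_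
  have hcard : Fintype.card {q : Fin (F.P K).d × Fin (F.P K).d // q.1 < q.2} = 3 := by
    rw [show (F.P K).d = 3 from rfl]; decide
  rw [hcard, show (F.P K).d = 3 from rfl]
  -- the exponent and the prefactor
  have hexp : (F.scheme ℰp γ).β K * θBal F.L γ b p₀ K ^ 2 / (2 * (2 : ℕ)) = 1 / 4 * B10.pFun b p₀ (Real.sqrt x) ^ 2 := by
    rw [beta_mul_θBal_sq F hγ]; ring
  have hsqrt : Real.sqrt ((F.scheme ℰp γ).β K) ^ (3 * (2 ^ 2 - 1)) ≤ (x⁻¹) ^ 5 := by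
    rw [show 3 * (2 ^ 2 - 1) = 9 by norm_num, ← hβ]
    set β := (F.scheme ℰp γ).β K
    have hs1 : Real.sqrt β ≤ β := by
      calc Real.sqrt β ≤ Real.sqrt β * Real.sqrt β :=
            le_mul_of_one_le_right (Real.sqrt_nonneg _) (Real.one_le_sqrt.mpr hβ1)
        _ = β := Real.mul_self_sqrt hβ0
    calc Real.sqrt β ^ 9 = (Real.sqrt β * Real.sqrt β) ^ 4 * Real.sqrt β := by ring
      _ = β ^ 4 * Real.sqrt β := by rw [Real.mul_self_sqrt hβ0]
      _ ≤ β ^ 4 * β := mul_le_mul_of_nonneg_left hs1 (pow_nonneg hβ0 4)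
      _ = β ^ 5 := by ring
  rw [hexp]
  have hK0 : 0 ≤ 2 * Real.exp (8 * (3 : ℕ)) * (c₀ ^ 3)⁻¹ := by positivity
  calc 2 * Real.exp (8 * (3 : ℕ)) * (c₀ ^ 3)⁻¹ * Real.sqrt ((F.scheme ℰp γ).β K) ^ (3 * (2 ^ 2 - 1)) *
        Real.exp (-(1 / 4 * B10.pFun b p₀ (Real.sqrt x) ^ 2))
      ≤ 2 * Real.exp (8 * (3 : ℕ)) * (c₀ ^ 3)⁻¹ * (x⁻¹) ^ 5 * Real.exp (-(1 / 4 * B10.pFun b p₀ (Real.sqrt x) ^ 2)) :=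
        mul_le_mul_of_nonneg_right (mul_le_mul_of_nonneg_left hsqrt hK0) (Real.exp_pos _).le
    _ = _ := by norm_num

/-! ## §2 `PlainStabAdd` from `LocalStepFloorExplicit` (one precision below the explicit slack rate) -/

/-- ★★ **`PlainStabAdd` ⇐ `LocalStepFloorExplicit`** — the interface of record `LocalStepFloor` (`PlainStabAddOfLocalStepFloor.plainStabAdd_of_localStepFloor`) with ONE precision:
for every `L, b₀ > 0, p₀ > 2` there are a base rate `c_b > 0`, a guard profile `b' > 0`, a precision `0 ≤ η < min(c_b, (b'/b₀)²/4)`, a starting run `k₀ ≥ 1`, `N_b`, a locality exponent `M`,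
`γ₁ ∈ (0,1]`, `C_b ≥ 0`, `A` such that every family `F` (`F.L = L`), `0 < γ ≤ γ₁`, unit plaquette label `q` admit `ρ`, `t ∈ [1/2,1]` and finest-plaquette sets `S_K` of run `K+1`,
`|S_K| ≤ (L^{K+1})^M` (`K ≥ k₀`), with (base) `Gibbs_{k₀}{t_{k₀}θ(0) ≤ |Ū^{k₀}(∂q) − 1|} ≤ C_b γ^{-N_b} e^{−c_b p(√γ)²}`, (slack) `Σ_{k≤j<K} ρ_j ≤ A + η·p(√γ)²` (`k ≥ k₀`), (step, `K ≥ k₀`)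
`Gibbs_{K+1}({t_{K+1}θ(0) ≤ |Ū^{K+1}(∂q) − 1|} ∩ PlaqSmallOn S_K θ_{b'}(K+1)) ≤ e^{ρ_K}·Gibbs_K{t_Kθ(0) ≤ |Ū^K(∂q) − 1|}`.  Conclusion `PlainStabAdd` with `c_τ = (b'/b₀)²/4`, `N_τ = 5`.
Conditional certificate: the hypothesis is NOT proved; nothing about the mass gap; rung R3 is a RECORD rung. [cite: Balaban1985UV3, (7) p.257 and (70)-(71) p.273; Balaban1987RG1, Thm 1 p.259] -/
theorem plainStabAdd_of_localStepFloorExplicit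
    (hLS : ∀ (L : ℕ) (b₀ p₀ : ℝ), 0 < b₀ → 2 < p₀ → ∃ (cb b' η : ℝ) (k₀ Nb M : ℕ) (γ₁ Cb A : ℝ),
      0 < cb ∧ 0 < b' ∧ 0 ≤ η ∧ η < cb ∧ η < (b' / b₀) ^ 2 / 4 ∧ 1 ≤ k₀ ∧ 0 < γ₁ ∧ γ₁ ≤ 1 ∧ 0 ≤ Cb ∧
      ∀ (F : T3Family) (γ : ℝ), F.L = L → 0 < γ → γ ≤ γ₁ →
        ∀ q : Plaq (F.P 0) 0, ∃ (ρ t : ℕ → ℝ) (S : (K : ℕ) → Finset (Plaq (F.P (K + 1)) 0)),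
          (∀ K : ℕ, 1 / 2 ≤ t K ∧ t K ≤ 1) ∧
          (gibbsK F ℰp γ k₀).real {U | t k₀ * θBal F.L γ b₀ p₀ 0 ≤ GaugeGroup.dist1 (GaugeField.plaqHol
                (Averaging.iter (fun i => BlockAveraging.blockAvg (P := F.P k₀) (j := i) ℰp) k₀ U) (plaqShift (F.sitesPerDir_unit k₀) q))} ≤
            Cb * (γ⁻¹) ^ Nb * Real.exp (-(cb * B10.pFun b₀ p₀ (Real.sqrt γ) ^ 2)) ∧
          (∀ k K : ℕ, k₀ ≤ k → ∑ j ∈ Finset.Ico k K, ρ j ≤ A + η * B10.pFun b₀ p₀ (Real.sqrt γ) ^ 2) ∧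
          (∀ K : ℕ, k₀ ≤ K → ((S K).card : ℝ) ≤ ((F.L : ℝ) ^ (K + 1)) ^ M) ∧
          ∀ K : ℕ, k₀ ≤ K →
            (gibbsK F ℰp γ (K + 1)).real ({U | t (K + 1) * θBal F.L γ b₀ p₀ 0 ≤ GaugeGroup.dist1 (GaugeField.plaqHol
                (Averaging.iter (fun i => BlockAveraging.blockAvg (P := F.P (K + 1)) (j := i) ℰp) (K + 1) U)
                (plaqShift (F.sitesPerDir_unit (K + 1)) q))} ∩
              {U | PlaqSmallOn (↑(S K) : Set (Plaq (F.P (K + 1)) 0)) (θBal F.L γ b' p₀ (K + 1)) U}) ≤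
            Real.exp (ρ K) *
            (gibbsK F ℰp γ K).real {U | t K * θBal F.L γ b₀ p₀ 0 ≤ GaugeGroup.dist1 (GaugeField.plaqHol
                (Averaging.iter (fun i => BlockAveraging.blockAvg (P := F.P K) (j := i) ℰp) K U)
                (plaqShift (F.sitesPerDir_unit K) q))}) :
    Summit.QuantumFields.YangMills.Theses.SmallFieldWidening.PlainStabAdd := by
  unfold Summit.QuantumFields.YangMills.Theses.SmallFieldWidening.PlainStabAdd
  intro L b₀ p₀ hb₀ hp₀
  obtain ⟨cb, b', η, k₀, Nb, M, γs, Cb, A, hcb, hb', hη0, hηb, hητ, hk₀, hγs, hγs1, hCb, hA⟩ := hLS L b₀ p₀ hb₀ hp₀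
  obtain ⟨C, hC, hfin0⟩ := finestTail_quarter
  by_cases hL : 1 < L
  swap
  · refine ⟨1, 0, 0, 1, 0, 1, 0, 1, 0, 0, le_rfl, one_pos, le_rfl, le_rfl, le_rfl, le_rfl, one_pos, one_pos, fun F γ hFL => ?_⟩
    exact absurd (hFL ▸ F.hL.2) hL
  have hp₀1 : 1 ≤ p₀ := by linarith
  set c : ℝ := 1 / 4 with hcdef
  have hc : 0 < c := by norm_num
  set cτ : ℝ := c * (b' / b₀) ^ 2 with hcτ
  have hητ' : η < cτ := by rw [hcτ, hcdef]; linarith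
  set Cτ : ℝ := 2 * (C * Real.exp (c * b' ^ 2) *
      Real.exp ((((M : ℝ) + (5 : ℕ)) * Real.log L + Real.log 2) ^ 2 / (4 * (c * b' ^ 2 * Real.log L ^ 2 / 4)))) with hCτ
  refine ⟨k₀, Nb, 5, γs, Cb, cb, Cτ, cτ, η, A, hk₀, hγs, hγs1, hCb, by positivity, hη0, hηb, hητ', fun F γ hFL hγ hle q => ?_⟩
  have hγ1 : γ ≤ 1 := hle.trans hγs1
  have hfin : ∀ (K : ℕ) (p : Plaq (F.P K) 0),
      (gibbsK F ℰp γ K).real {U | θBal F.L γ b' p₀ K ≤ GaugeGroup.dist1 (GaugeField.plaqHol U p)} ≤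
        C * ((γ * ((F.L : ℝ)⁻¹) ^ K)⁻¹) ^ 5 * Real.exp (-(c * B10.pFun b' p₀ (Real.sqrt (γ * ((F.L : ℝ)⁻¹) ^ K)) ^ 2)) :=
    fun K p => hfin0 F γ b' p₀ hγ hγ1 hb' K p
  obtain ⟨ρ, t, S, ht, hbase, hρ, hS, hst⟩ := hA F γ hFL hγ hle q
  refine ⟨ρ, fun K => ((S K).card : ℝ) * (C * ((γ * ((F.L : ℝ)⁻¹) ^ (K + 1))⁻¹) ^ 5 *
      Real.exp (-(c * B10.pFun b' p₀ (Real.sqrt (γ * ((F.L : ℝ)⁻¹) ^ (K + 1))) ^ 2))), t, ht, hbase, hρ,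
    fun K => by positivity, fun K => ?_, fun K hK => ?_⟩
  · -- the slack budget, uniformly in `K`, `γ` and the volume
    rw [hFL]
    have hsum := slack_sum_le hL M 5 k₀ hb' hp₀1 hc hC hγ hγ1 (fun k => ((S k).card : ℝ)) (fun k hk => hFL ▸ hS k hk) K
    rw [pFun_sq_rescale hb₀.ne' b' p₀ (Real.sqrt γ)] at hsum
    have heq : -(c * ((b' / b₀) ^ 2 * B10.pFun b₀ p₀ (Real.sqrt γ) ^ 2)) = -(cτ * B10.pFun b₀ p₀ (Real.sqrt γ) ^ 2) := by
      rw [hcτ]; ring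
    rw [heq] at hsum
    exact hsum
  · -- the step: split on the local finest-small-field event, union bound on its complement
    haveI := isProbabilityMeasure_gibbsK F ℰp hγ.le (K + 1)
    have hb : ∀ p : Plaq (F.P (K + 1)) 0,
        (gibbsK F ℰp γ (K + 1)).real {U | θBal F.L γ b' p₀ (K + 1) ≤ GaugeGroup.dist1 (GaugeField.plaqHol U p)} ≤
          C * ((γ * ((F.L : ℝ)⁻¹) ^ (K + 1))⁻¹) ^ 5 *
            Real.exp (-(c * B10.pFun b' p₀ (Real.sqrt (γ * ((F.L : ℝ)⁻¹) ^ (K + 1))) ^ 2)) := fun p =>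
      hfin (K + 1) p
    set E : Set (GaugeField (F.P (K + 1)) 0 (Matrix.specialUnitaryGroup (Fin 2) ℂ)) :=
      {U | t (K + 1) * θBal F.L γ b₀ p₀ 0 ≤ GaugeGroup.dist1 (GaugeField.plaqHol
        (Averaging.iter (fun i => BlockAveraging.blockAvg (P := F.P (K + 1)) (j := i) ℰp) (K + 1) U)
        (plaqShift (F.sitesPerDir_unit (K + 1)) q))} with hE
    set G : Set (GaugeField (F.P (K + 1)) 0 (Matrix.specialUnitaryGroup (Fin 2) ℂ)) :=
      {U | PlaqSmallOn (↑(S K) : Set (Plaq (F.P (K + 1)) 0)) (θBal F.L γ b' p₀ (K + 1)) U} with hG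
    have hsplit : E ⊆ (E ∩ G) ∪ ⋃ p ∈ S K,
        {U : GaugeField (F.P (K + 1)) 0 (Matrix.specialUnitaryGroup (Fin 2) ℂ) |
          θBal F.L γ b' p₀ (K + 1) ≤ GaugeGroup.dist1 (GaugeField.plaqHol U p)} := by
      intro U hU
      by_cases hGU : U ∈ G
      · exact Or.inl ⟨hU, hGU⟩
      · right
        simp only [hG, Set.mem_setOf_eq, PlaqSmallOn, Finset.mem_coe, not_forall, not_lt, exists_prop] at hGU
        obtain ⟨p, hp, hle'⟩ := hGU
        exact Set.mem_iUnion₂.mpr ⟨p, hp, hle'⟩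
    calc (gibbsK F ℰp γ (K + 1)).real E
        ≤ (gibbsK F ℰp γ (K + 1)).real ((E ∩ G) ∪ ⋃ p ∈ S K,
            {U : GaugeField (F.P (K + 1)) 0 (Matrix.specialUnitaryGroup (Fin 2) ℂ) |
              θBal F.L γ b' p₀ (K + 1) ≤ GaugeGroup.dist1 (GaugeField.plaqHol U p)}) :=
          measureReal_mono hsplit (measure_ne_top _ _)
      _ ≤ (gibbsK F ℰp γ (K + 1)).real (E ∩ G) + (gibbsK F ℰp γ (K + 1)).real (⋃ p ∈ S K,
            {U : GaugeField (F.P (K + 1)) 0 (Matrix.specialUnitaryGroup (Fin 2) ℂ) |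
              θBal F.L γ b' p₀ (K + 1) ≤ GaugeGroup.dist1 (GaugeField.plaqHol U p)}) :=
          measureReal_union_le _ _
      _ ≤ Real.exp (ρ K) * (gibbsK F ℰp γ K).real {U | t K * θBal F.L γ b₀ p₀ 0 ≤ GaugeGroup.dist1 (GaugeField.plaqHol
              (Averaging.iter (fun i => BlockAveraging.blockAvg (P := F.P K) (j := i) ℰp) K U)
              (plaqShift (F.sitesPerDir_unit K) q))} +
            ∑ p ∈ S K, (gibbsK F ℰp γ (K + 1)).real
              {U : GaugeField (F.P (K + 1)) 0 (Matrix.specialUnitaryGroup (Fin 2) ℂ) |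
                θBal F.L γ b' p₀ (K + 1) ≤ GaugeGroup.dist1 (GaugeField.plaqHol U p)} :=
          add_le_add (hst K hK) (measureReal_biUnion_finset_le _ _)
      _ ≤ Real.exp (ρ K) * (gibbsK F ℰp γ K).real {U | t K * θBal F.L γ b₀ p₀ 0 ≤ GaugeGroup.dist1 (GaugeField.plaqHol
              (Averaging.iter (fun i => BlockAveraging.blockAvg (P := F.P K) (j := i) ℰp) K U)
              (plaqShift (F.sitesPerDir_unit K) q))} +
            ∑ _p ∈ S K, C * ((γ * ((F.L : ℝ)⁻¹) ^ (K + 1))⁻¹) ^ 5 *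
              Real.exp (-(c * B10.pFun b' p₀ (Real.sqrt (γ * ((F.L : ℝ)⁻¹) ^ (K + 1))) ^ 2)) :=
          add_le_add le_rfl (Finset.sum_le_sum fun p _ => hb p)
      _ = _ := by rw [Finset.sum_const, nsmul_eq_mul]

end Summit.QuantumFields.YangMills.Theorems.PlainStabAddOfLocalStepFloorExplicit

end
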